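import Mathlib
import HarnessLib
import HarnessLib.Audit
import Summits.PneNP.Statement
import Literature.Computability.Complexity.Oracle
import Literature.Computability.Complexity.BoolEncodings
import Literature.Computability.Complexity.Classes
import Literature.Computability.Complexity.Nondeterministic
import Literature.Computability.Complexity.ClayProblem
import Literature.Computability.Complexity.NPBridge
import HarnessLib.Audit.Status.Attr

/-!
Route: NoTardosTropics

DORMANT since 2026-08-22T02:42:10Z (reconciler: no traction for 5 d (last activity item-evidence-added at 2026-08-17T02:04:53Z); parked, not closed — `ledger route dormant route-PneNP-NoTardosTropics --off` to reactivate) — unstaffed, not closed; items shared with open routes are served there. `ledger route dormant <id> --off` reactivates.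

X_add — "no Tardos theorem for the tropics" (idea card
PneNP/PneNP/no-tardos-for-tropics-additive-transfer). It suffices to show: real-weight mean-payoff
games have no strongly polynomial ADDITIVE algorithm, i.e. no polynomial-time parameter-free machine
over (ℝ,+,−,<) (Koiran's class P⁰_Rovs) decides, given a game graph with arbitrary real edge
weights, whether the mean-payoff value of the start vertex is ≥ 0. Model used (over existing Lean
declarations, no new definitions): a P⁰_Rovs machine = a polynomial-time oracle algorithm
`Literature.Computability.Complexity.OracleAlg Bool` (step function `IsPolyTime`, `q(n)` rounds on
input `unaryEncodeNat n`) whose only access to the real input x ∈ ℝⁿ is the SIGN ORACLE qry ↦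
encodeBool (0 ≤ c + Σᵢ aᵢ·xᵢ), the integers (c, a₀, …, a_{n−1}) being decoded from qry by
`encodingIntBool.listBool` — equivalent to Koiran's additive machines up to polynomial factors
(symbolic simulation; all tests of a time-q machine are integer affine forms with coefficients ≤
2^q, [FournierKoiran2000, Remark 1 p.4]). MPG_ℝ(n) := {x ∈ ℝⁿ : n = k + 2k² read as k owner bits, k²
edge indicators, k² weights; arena total; ∃ positional strategy σ of Max, ∃ R ∋ vertex 0 closed
under σ at Max vertices and under all edges at Min vertices, ∃ potential π : Fin k → ℝ with
π(target) ≤ π(source) + weight on every such R-edge} (= "value(0) ≥ 0" by Ehrenfeucht–Mycielski;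
that equivalence is interpretation only, never load-bearing).
Lean (decl `XAdd`, elaborates — folder Sketch.lean rc 0): ¬ ∃ M :
Literature.Computability.Complexity.OracleAlg Bool, M.IsPolyTime Computability.encodingBoolBool ∧ ∃
q : Polynomial ℕ, ∀ (n : ℕ) (x : Fin n → ℝ), M.run (signOracle x) (q.eval n)
(Computability.unaryEncodeNat n) = some (decide (x ∈ MPG_ℝ n))   [signOracle and MPG_ℝ inlined].
Assembly X_add → PneNP: Fournier–Koiran [FournierKoiran2000, Thm 3 p.10 with Fact 2 (NP⁰ = NDP⁰)]:
NDP⁰_Rovs ⊆ P⁰_Rovs(NP) (crux FKThm3Digital, a published theorem to be formalised in this model);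
MPG_ℝ ∈ NDP⁰_Rovs (support: Boolean certificate σ,R; Bellman–Ford uses +,−,< only); if P = NP the
Boolean NP oracle is removable (support OracleRemoval); hence P = NP ⇒ MPG_ℝ ∈ P⁰_Rovs,
contradicting X_add. DECIDING THEOREM (D-0027 §2.1, planner glue, certified: lean rc 0,
h21_check_closes ok, axioms propext/Classical.choice/Quot.sound): `closes : XAdd → FKThm3Digital →
MPGRealMemNDPadd → OracleRemoval → PneNP` — pure logic; the PROVED model bridges
`Literature.Computability.Complexity.P_bool_eq_holds` (P_w0 Bool = Classes.P) and
`Literature.Computability.Complexity.NP_subset_NP_bool` (Nondeterministic.NP ⊆ NP_w0 Bool, NPBridge)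
are used INSIDE the proof, never as hypotheses. Assembly decl (restated 2026-08-15 to the same
telescope, items only): XAdd → FKThm3Digital → MPGRealMemNDPadd → OracleRemoval → _root_.PneNP —
provable now by `exact closes`; the route is decided exactly when XAdd, FKThm3Digital,
MPGRealMemNDPadd and OracleRemoval are proved (NoTropicalTardos/FKLoweringMPG feed XAdd via
GlueNoTardos and the kill criteria).

Rationale: WHY THIS LINE. Imports: real/additive BSS complexity [Koiran1994, FournierKoiran1998,
FournierKoiran2000]; tropical LP and mean-payoff games [AllamigeonEtAl2014,
GurvichKarzanovKhachivan1988, ZwickPaterson1996, EhrenfeuchtMycielski1979, Karp1978];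
strongly-polynomial rounding [FrankTardos1987]. X_add is implied by the Boolean conjecture 'MPG ∉ P'
(a P⁰_Rovs machine is simulated by a TM on binary integer weights; support BooleanShadow) and still
implies P ≠ NP by Fournier–Koiran's transfer [FournierKoiran2000, Thm 3 p.10 + Fact 2] — a
WEAKER-looking summit witness living in a model without bit access: every known MPG algorithm
(value/strategy iteration, GKK, Zwick–Paterson) is additive and none is polynomial; 'strongly
polynomial MPG' is open since 1988 and is exactly what a combinatorial strongly-polynomial simplex
rule would deliver [AllamigeonEtAl2014] (so X_add ⇒ a negative answer to the pivoting form of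
Smale's 9th problem [Smale1998]). No capture conjecture is needed: the quantifier ranges over
additive machines only. The non-uniform analogue of X_add is FALSE (Meyer auf der Heide / Meiser
point location [Meyeraufderheide1984, Meiser1993]; support MadHNonuniform) and with an NP oracle the
uniform machine exists [FournierKoiran2000, Thm 2 p.4, Remark 2 p.11]: the entire content of X_add
is the power of the Boolean control between P and P^NP. FK report read in full
(galaxy-pdf-1066243140 = hal-02102035): its location procedure spends the NP oracle on 'does a
hyperplane of the succinct arrangement meet this little cube' + prefix search (p.6); for the
cycle-mean arrangement of MPG that sub-question embeds ZERO-WEIGHT CYCLE (NP-complete via the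
subset-sum path gadget) while deciding the game needs less than full location — this gap is where
cruxes #3/#4 sit. Model: P⁰_Rovs is rendered WITHOUT new definitions as
Literature.Computability.Complexity.OracleAlg + the sign oracle of x (queries = integer affine forms
via encodingIntBool.listBool; equivalent to Koiran's parameter-free additive machines up to
polynomial factors by symbolic simulation, FK Remark 1). Withdrawn from the card, with reason: the
'scale-pumping ⇒ separating automata' crux is dead as a black-box statement — an extraction of small
universal graphs from an arbitrary poly-round sign-query algorithm would apply to non-uniform trees
(MadH) and to NP-oracle machines (FK Thm 2), contradicting [CzerwinskiEtAl2019]; it must be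
white-box in the P step function, i.e. it is X_add itself. Universal-graph / strategy-iteration
lower bounds [CzerwinskiEtAl2019, arXiv:1812.07072, Friedmann2009] remain restricted-class evidence,
not items.

RANKED CRUXES. #2 FKThm3Digital (re-badged support by retriage 2026-08-15: a published theorem;
keeps rank 2 as the first formalisation debt) — every NDP⁰_add real language is decided by a
poly-time sign-query algorithm with some Boolean NP oracle [FournierKoiran2000, Thm 3 + Thm 2;
published theorem, unproved in Lean, made the FIRST crux per the plancard rule] (why it might fail:
only a model mismatch of the OracleAlg rendering — unary size input, 1-bit answers, listBool query
codec; the mathematics is MadH recursion + coefficient bounds §2.2 + NP prefix search). #3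
NoTropicalTardos — MPG_ℝ ∉ P⁰_add EVEN WITH a free oracle for integer-weight MPG: no
strongly-polynomial additive reduction of real to integer mean payoff, no tropical Frank–Tardos; ⇒
X_add (GlueNoTardos) ⇒ P ≠ NP (why it might fail: a lexicographic-Euclid / scale-clustering
reduction may exist — Frank–Tardos does this for linear objectives with floor/LLL, unavailable
additively at unbounded spread; sources FrankTardos1987, FournierKoiran2000 p.6,
AllamigeonEtAl2014). #4 FKLoweringMPG — SOME NP∩coNP language already suffices as FK's oracle for
MPG_ℝ; constructive kill-side crux, provable by a construction, its negation implies #3 given MPG_ℤ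
∈ NP∩coNP [ZwickPaterson1996] (why it might fail: FK's location needs NP for zero-cycle questions
and no way to decide MPG_ℝ without locating is known). Target #0 XAdd; #1 Assembly = XAdd →
FKThm3Digital → MPGRealMemNDPadd → OracleRemoval → _root_.PneNP (items only; the deciding theorem
`closes` with this exact telescope is proved glue in the route file, so `exact closes` closes #1).

KILL CRITERIA. XAdd refuted (= a strongly polynomial additive MPG algorithm; landmark
[GurvichKarzanovKhachivan1988 open problem]) closes the route refuted. NoTropicalTardos refuted (a
tropical Frank–Tardos reduction MPG_ℝ → MPG_ℤ) ⇒ the line's content collapses onto Boolean 'MPG ∉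
P': close superseded by the tropical-limit-games line. FKThm3Digital refuted ⇒ a MODEL bug
(sign-oracle rendering), restate, do not pivot. FKLoweringMPG proved with an exotic A ⇒ re-rank:
X_add then says 'that A ∉ P' plus scale content; proved with A = MPG_ℤ ⇒ same as NoTropicalTardos
refuted. Parity or MPG ∈ P proved Boolean-side [CaludeEtAl2017 warns] ⇒ X_add loses its 'implied by
MPG ∉ P' backstop but stands.

NOT DECOMPOSED YET. MPG_ℝ ∈ coNDP⁰ and MPG_ℤ ∈ NP∩coNP (need Ehrenfeucht–Mycielski formalised;
interpretive only); the parity-game degeneration w_e = (−T)^{p_e} (¬X_add ⇒ parity ∈ P) until parity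
games are defined; round/adaptivity lower bounds for sign-query protocols (provable, off the
critical path); restricted-coefficient trees (non-uniformly still poly-depth by generalized
comparisons [KaneLovettMoran2019], so no cheap rung); energy/discounted/simple-stochastic variants;
an in-model relativisation record (∃ A ∈ PSPACE, MPG_ℝ ∈ P⁰_add^A). The point-location sibling card
(uniform-point-location-additive-reals: Knapsack_ℝ, NP⁰-complete, X ⟺ P ≠ NP) is a different object
— ours is well-characterised, strictly weaker than the additive form of P ≠ NP, and cruxes #3/#4
have no Knapsack analogue.

CHEAPEST FALSIFIER. Try to build the tropical Frank–Tardos reduction on TWO scales: real weights w_e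
= m_e + ε·m'_e (integers m, m' of poly bits, ε infinitesimal = lexicographic MPG) are decided by two
integer-MPG oracle calls plus tie analysis; if the k-scale lexicographic case already needs
super-polynomially many oracle calls or exact zero-cycle detection, NoTropicalTardos gains evidence;
if an additive machine can DISCOVER an arbitrary real input's scale/near-relation structure with
poly many sign queries and reduce to lexicographic integer MPG, NoTropicalTardos is refuted and the
route collapses (one week of pencil work; no compute needed). Second: check in [FournierKoiran2000
§2] whether for hyperplane families with {−1,0,1} coefficients the cube-emptiness question is the
ONLY NP use (it is, p.6) and whether for the cycle arrangement it is NP-hard (zero-weight cycle: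
yes) — done this session, recorded.

TWO-LAYER PLAN. Glue foreseen after a crux closes: NoTropicalTardos → XAdd (filed, GlueNoTardos,
routine: route sign queries through the tag bit); ¬FKLoweringMPG → NoTropicalTardos needs MPG_ℤ ∈ NP
∩ coNP as a cite fact (Zwick–Paterson / Ehrenfeucht–Mycielski); FKThm3Digital splits naturally into
Location (FK Thm 2 in the sign-oracle model) → CellDecision (NP check of a located cell, FK p.11) →
FKThm3Digital; MPGRealMemNDPadd splits into PotentialIffNoNegCycle (Farkas on a finite digraph) →
BellmanFordSignQueries (an IsPolyTime step function) → MPGRealMemNDPadd.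

DEFINITION REQUESTS. (i) AdditiveRealClasses — VENDORED as
Literature/Computability/Complexity/AdditiveRealClasses.lean (RealLanguage, signOracle,
signOracleWith, PAdd, NDPAdd, PAddRel, PAddRelClass; refuter dictionary probe rc 0: every machine
item here is Iff.rfl-equal to its named-class form — XAdd ↔ MPG ∉ PAdd, MPGRealMemNDPadd ↔ MPG ∈
NDPAdd, FKThm3Digital ↔ NDPAdd ⊆ PAddRelClass NP, NoTropicalTardos ↔ MPG ∉ PAddRel MPG_ℤ); provers
may `show` the named form and use its API; restating the filed signatures over the names is left to
a tenure pass (not done in the glue repair, to keep stamps); (ii) MeanPayoffGame — finite arenas,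
positional strategies, the yes-set 'value(v) ≥ 0' in the potential form used here, real and integer
weights, Boolean encoding. Item (ii) is still typed inline.

SUPPORT. MPGRealMemNDPadd (Bellman–Ford certificate check; hypothesis of `closes`), OracleRemoval (a
P oracle is simulable inside the step function; hypothesis of `closes`), BooleanShadow
(P⁰_add(MPG_ℝ) ⇒ MPG_ℤ ∈ P: X_add is weaker than the Boolean conjecture), MadHNonuniform
(non-uniform poly-depth sign trees with poly-bit queries exist [Meyeraufderheide1984, Meiser1993,
FournierKoiran2000 §2.2]: natural proofs inapplicable, uniformity is the content), GlueNoTardos (#3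
→ #0). CONE HYGIENE for provers: the route file imports Oracle, BoolEncodings, Classes,
Nondeterministic, ClayProblem, NPBridge; a Theorems file proving an item needs only
`Summits.PneNP.PneNP.Theses.NoTardosTropics` (or Oracle + BoolEncodings + Classes/Nondeterministic
for the classes it mentions) — do not import ClayProblemProofs/StructuralPH.

Novelty: NEAREST PRIOR ART (searched 2026-08-15; card + 2nd-opinion audit searches inherited: zbMATH 'mean
payoff games strongly polynomial', crossref/arXiv sweeps for 'Fournier Koiran', 'combinatorial
simplex mean payoff', lit frontier/bridges PneNP; this session: full read of the FK report
galaxy-pdf-1066243140 = hal-02102035 (Thm 1 p.2, Cor 1 p.3, Thm 2 + Remark 1 p.4, Lemma 1–2 pp.5–6,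
Fact 1–2 + Thm 3 p.10, Remark 2 p.11), lit galaxy search --star all "strongly polynomial algorithm
for mean payoff" / "mean-payoff games with real weights" (0 rows), galaxy pdf --mode intelligent
'strongly polynomial MPG; Frank–Tardos-style weight reduction for mean payoff/energy games' (10
rows: Jurdzinski1998, Chatterjee–Doyen–Henzinger–Raskin energy games, Bouyer et al. average-energy,
Végh's strongly-polynomial lecture notes, Wayne generalized flow — none reduces real to integer MPG
or mentions additive machines), zbMATH remote (1 irrelevant row), crossref 'zero weight cycle
NP-complete' (no dedicated source; folklore subset-sum gadget); OpenAlex/S2/arXiv HTTP 429 today,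
local searchd down (rc 104)).
(1) FournierKoiran2000 (doi:10.1007/3-540-45022-x_70): the transfer NP⁰_Rovs ⊆ P⁰_Rovs(NP) and
P⁰_Rovs = NP⁰_Rovs ⟺ P = NP, applied by the authors only to NP⁰_Rovs-complete problems (Knapsack_ℝ,
TSP_ℝ, Prop 2 p.12) with the pessimistic moral "lower bounds are not easier". (2) AllamigeonEtAl2014
(doi:10.1137/140953800 = arXiv:1309.5925): combinatorial strongly-polynomial simplex ⇒
strongly-polynomial  [refs: 10.1007/3-540-45022-x_70, 10.1137/140953800, 10.1007/BF02579200, 1309.5925, doi:10.1007/3-540-45022-x_70, doi:10.1137/140953800, doi:10.1007/BF02579200, Jurdzinski1998, FournierKoiran2000, AllamigeonEtAl2014, FrankTardos1987]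

Barriers (technique_class: additive-reals, transfer, uniformity, tropical-games): - technique_class: additive-reals, transfer, uniformity, tropical-games
- Literature.Barriers.PneNP.Relativization: NOT evaded at thesis level and the route says exactly
where it bites. FK's transfer relativizes (give the Boolean oracle A to both the TM and the additive
machine's control): relative to a PSPACE-complete A the uniform point-location machine exists
([FournierKoiran2000, Remark 2 p.11]: PAR⁰_Rovs ⊆ P⁰_Rovs(PSPACE)), so MPG_ℝ ∈ P⁰_add^A while
X_add^∅ is the target — any proof of X_add, NoTropicalTardos or ¬FKLoweringMPG must distinguish a P
step function from a P^A step function, i.e. is a non-relativizing proof of P ≠ NP in additive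
clothing. In-model form of the barrier (recorded, not filed): ∃ A ∈ PSPACE with MPG_ℝ ∈ P⁰_add^A.
The bet: the additive model makes the non-relativizing ingredient CONCRETE — the object to analyse
is the sequence of integer test vectors a poly-time TM can generate across all scales of one real
input, and crux #3 (no additive reduction real → integer MPG) is a statement about
Diophantine/valuation structure (lexicographic Euclid, near-relations among weights) on which
number-theoretic tools act and oracles do not appear; this is a white-box hope of the
gate-elimination kind, not an evasion.
- Literature.Barriers.PneNP.RelativizationNarrow: the narrowed relativization entry
(RelativizationSparse.lean) applies exactly as Relativization does — the collapsing oracle that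
defeats X_add^A is DENSE (PSPACE-complete), matching the entry's scop

History (route lifecycle, newest last):
- 2026-08-15T16:17:30Z · rev 2: restated Assembly (stmt-PneNP-2572) — route-repair (glue, rbadge g2): deciding theorem `closes : XAdd → FKThm3Digital → MPGRealMemNDPadd → OracleRemoval → PneNP` PROVED (folder GlueCheck.lean = woul (planner-rbadge-PneNP-NoTardosTropics-b759eda1-g2-0)
- 2026-08-16T02:17:41Z · AUTO-CRUX: 1 conjecture-grade item(s) promoted to crux (BooleanShadow) — refuter vetting / tiering apply (operator:999:1362873)
- 2026-08-16T04:14:31Z · AUTO-CRUX (backfill): XAdd — hypotheses of the deciding theorem that nothing in the route derives are cruxes (operator:999:1085951)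
- 2026-08-22T02:42:10Z · DORMANT — reconciler: no traction for 5 d (last activity item-evidence-added at 2026-08-17T02:04:53Z); parked, not closed — `ledger route dormant route-PneNP-NoTardosTrop (operator:999:2407291)

sub-problem: PneNP · status: dormant · opened planner-plancard-PneNP-PneNP-no-tardos-for-tr-9cb382de-0 2026-08-15T11:05:30Z · rev 2 · ledger route-PneNP-NoTardosTropics
GENERATED by the gate from the ledger (D-0016/17). Provers cite these decls: `theorem foo : Summit.PneNP.PneNP.Theses.NoTardosTropics.<Decl> := …` in Summits/PneNP/PneNP/Theorems/<Name>.lean.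
-/

namespace Summit.PneNP.PneNP.Theses.NoTardosTropics

open scoped BigOperators Topology Manifold Classical MeasureTheory ProbabilityTheory Matrix InnerProductSpace ComplexConjugate ContinuousMap
open Filter Set Function TopologicalSpace MeasureTheory

attribute [summit_statement] _root_.PneNP

open Literature.PNP

/-- item stmt-PneNP-2563 · crux (kind.auto-crux: conjecture-grade) · rank 0 · open · by planner
why it might fail: A strongly polynomial ADDITIVE mean-payoff algorithm may exist: open since GKK 1988, every known MPG algorithm is additive, a combinatorial strongly-polynomial simplex pivoting rule would give one (AllamigeonEtAl2014), and parity games fell to quasi-polynomial time in 2017 (CaludeEtAl2017).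
sources: GurvichKarzanovKhachivan1988, AllamigeonEtAl2014, CaludeEtAl2017, FournierKoiran2000, Koiran1994
[target] X_add: no polynomial-time parameter-free additive machine over (ℝ,+,−,<) — rendered as a
poly-time OracleAlg whose only access to x ∈ ℝⁿ is the sign oracle qry ↦ [0 ≤ c + Σ aᵢxᵢ], (c,a)
decoded by encodingIntBool.listBool, q(n) rounds on input unaryEncodeNat n — decides the real
mean-payoff language MPG_ℝ(n) = {x : n = k+2k² read as k owner bits (=1 ↔ Max), k² edge indicators
(=1 ↔ edge), k² weights; arena total; ∃ positional σ of Max, ∃ R ∋ vertex 0 closed under σ at Max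
vertices and under every edge at Min vertices, ∃ potential π with π(target) ≤ π(source)+weight on
those edges} (= value(0) ≥ 0 by Ehrenfeucht–Mycielski, interpretive only). Why it might fail: a
strongly polynomial additive MPG algorithm (open since GKK 1988; a combinatorial strongly-poly
simplex rule would give one [AllamigeonEtAl2014]); the 2017 quasi-polynomial parity surprise
[CaludeEtAl2017]. Implied by Boolean 'MPG ∉ P' (BooleanShadow). [sources:
GurvichKarzanovKhachivan1988; AllamigeonEtAl2014; FournierKoiran2000; Koiran1994] -/
@[route_item "route-PneNP-NoTardosTropics", crux]
def XAdd : Prop :=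
  ¬ (∃ M : Literature.Computability.Complexity.OracleAlg Bool, M.IsPolyTime Computability.encodingBoolBool ∧ ∃ q : Polynomial ℕ, ∀ (n : ℕ) (x : Fin n → ℝ), M.run (fun qry : List Bool => Computability.encodeBool (decide ((0 : ℝ) ≤ ((Literature.Computability.Complexity.encodingIntBool.listBool).decode qry).elim (0 : ℝ) (fun l : List ℤ => ((l.getD 0 0 : ℤ) : ℝ) + ∑ i : Fin n, ((l.getD (i.val + 1) 0 : ℤ) : ℝ) * x i)))) (q.eval n) (Computability.unaryEncodeNat n) = some (@decide (let g : ℕ → ℝ := fun m => (List.ofFn x).getD m 0; ∃ k : ℕ, 0 < k ∧ n = k + 2 * k * k ∧ ((∀ u : Fin k, ∃ u' : Fin k, g (k + (u.val * k + u'.val)) = 1) ∧ ∃ (σ : Fin k → Fin k) (R : Set (Fin k)) (π : Fin k → ℝ), (∃ v ∈ R, v.val = 0) ∧ ∀ u ∈ R, (g u.val = 1 → g (k + (u.val * k + (σ u).val)) = 1 ∧ σ u ∈ R ∧ π (σ u) ≤ π u + g (k + k * k + (u.val * k + (σ u).val))) ∧ (g u.val ≠ 1 → ∀ u' : Fin k,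 g (k + (u.val * k + u'.val)) = 1 → u' ∈ R ∧ π u' ≤ π u + g (k + k * k + (u.val * k + u'.val))))) (Classical.dec _)))

/-- item stmt-PneNP-2565 · crux · rank 3 · open · by planner
why it might fail: False if a 'tropical Frank–Tardos' exists: binary search on ratios, Euclid on near-relations, scale clustering, plus integer-MPG oracle calls on rounded/lexicographic games, deciding MPG_R with poly many poly-bit sign queries; non-uniformly such search trees exist (MadH): only uniformity protects it
sources: FrankTardos1987, FournierKoiran2000, AllamigeonEtAl2014, ZwickPaterson1996, Meyeraufderheide1984, KaneLovettMoran2019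
[crux] No Tardos theorem for the tropics (the distinctive content of the line): even relative to a
free oracle for INTEGER-weight mean-payoff games (the Boolean language MPG_ℤ :=
encodingIntBool.listBool-image of lists [k, owner₀..owner_{k−1}, k² edge indicators, k² integer
weights] satisfying the same yes-predicate), no poly-time sign-query algorithm decides MPG_ℝ — i.e.
real mean payoff is NOT strongly-polynomially (additively) reducible to integer mean payoff;
contrast Frank–Tardos 1987, whose simultaneous-Diophantine rounding makes every combinatorial LP
strongly polynomial but needs floor/LLL on the input numbers. NoTropicalTardos ⇒ XAdd (GlueNoTardos)
⇒ P ≠ NP. Evidence: FK's location for the cycle-mean arrangement asks 'does some cycle have mean in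
a tiny interval' = zero-weight-cycle, NP-complete, so full location is not available from an NP∩coNP
oracle unless NP ⊆ P^{NP∩coNP}; the game needs less than location, which is the open gap. [deps:
XAdd] [difficulty: open-problem] -/
@[route_item "route-PneNP-NoTardosTropics"]
def NoTropicalTardos : Prop :=
  ¬ (∃ M : Literature.Computability.Complexity.OracleAlg Bool, M.IsPolyTime Computability.encodingBoolBool ∧ ∃ q : Polynomial ℕ, ∀ (n : ℕ) (x : Fin n → ℝ), M.run (fun qry : List Bool => cond (qry.headD false) (Computability.encodeBool (@decide (qry.tail ∈ ((Literature.Computability.Complexity.encodingIntBool.listBool).toLanguage {l : List ℤ | let g : ℕ → ℝ := fun m => ((l.getD (m + 1) 0 : ℤ) : ℝ); ∃ k : ℕ, 0 < k ∧ l.length = 1 + (k + 2 * k * k) ∧ l.getD 0 0 = (k : ℤ) ∧ ((∀ u : Fin k, ∃ u' : Fin k, g (k + (u.val * k + u'.val)) = 1) ∧ ∃ (σ : Fin k → Fin k) (R : Set (Fin k)) (π : Fin k → ℝ), (∃ v ∈ R, v.val = 0) ∧ ∀ u ∈ R, (g u.val = 1 → g (k + (u.val * k + (σ u).val)) = 1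 ∧ σ u ∈ R ∧ π (σ u) ≤ π u + g (k + k * k + (u.val * k + (σ u).val))) ∧ (g u.val ≠ 1 → ∀ u' : Fin k, g (k + (u.val * k + u'.val)) = 1 → u' ∈ R ∧ π u' ≤ π u + g (k + k * k + (u.val * k + u'.val))))})) (Classical.dec _))) ((fun qry : List Bool => Computability.encodeBool (decide ((0 : ℝ) ≤ ((Literature.Computability.Complexity.encodingIntBool.listBool).decode qry).elim (0 : ℝ) (fun l : List ℤ => ((l.getD 0 0 : ℤ) : ℝ) + ∑ i : Fin n, ((l.getD (i.val + 1) 0 : ℤ) : ℝ) * x i)))) qry.tail)) (q.eval n) (Computability.unaryEncodeNat n) = some (@decide (let g : ℕ → ℝ := fun m => (List.ofFn x).getD m 0; ∃ k : ℕ, 0 < k ∧ n = k + 2 * k * k ∧ ((∀ u : Fin k, ∃ u' : Fin k, g (k + (u.val * k + u'.val)) = 1) ∧ ∃ (σ : Fin k → Fin k) (R : Set (Fin k)) (π : Fin k → ℝ), (∃ v ∈ R, v.val = 0) ∧ ∀ u ∈ R, (g u.val = 1 → g (k + (u.val * k + (σ u).val)) = 1 ∧ σ u ∈ R ∧ π (σ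 u) ≤ π u + g (k + k * k + (u.val * k + (σ u).val))) ∧ (g u.val ≠ 1 → ∀ u' : Fin k, g (k + (u.val * k + u'.val)) = 1 → u' ∈ R ∧ π u' ≤ π u + g (k + k * k + (u.val * k + u'.val))))) (Classical.dec _)))

/-- item stmt-PneNP-2566 · crux · rank 4 · open · by planner
why it might fail: May be false: FK's location asks its oracle 'does a hyperplane of the succinct cycle arrangement cut this cube' (simple zero-cycle/subset-sum, NP-complete), which P^(NP∩coNP) = NP∩coNP cannot answer unless NP = coNP; no way to decide MPG_R short of locating x is known; its negation is summit-hard.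
sources: FournierKoiran2000, paper:galaxy-pdf-1066243140, ZwickPaterson1996, EhrenfeuchtMycielski1979, Jurdzinski1998
[crux] FK's oracle can be lowered for a well-characterised problem: there is a Boolean language A
with A ∈ NP and Aᶜ ∈ NP such that MPG_ℝ is decided by a poly-time sign-query algorithm with oracle
A. Constructive, kill-side crux (provable by a construction, not summit-hard); FK give A = SAT
[FournierKoiran2000, Thm 3 + Remark 2: the class check is NP∩coNP-easy for MPG but LOCATION costs
NP]. Its negation (∀ A ∈ NP∩coNP, MPG_ℝ ∉ P⁰_add^A) implies NoTropicalTardos given MPG_ℤ ∈ NP∩coNP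
[ZwickPaterson1996, EhrenfeuchtMycielski1979] and is summit-strength. Informative either way: proved
with an exotic A ⇒ the scale content of X_add is NP∩coNP-easy; proved with A = MPG_ℤ ⇒
NoTropicalTardos refuted. [deps: none] [difficulty: L] -/
@[route_item "route-PneNP-NoTardosTropics"]
def FKLoweringMPG : Prop :=
  ∃ A : Language Bool, A ∈ Literature.Computability.Complexity.Nondeterministic.NP ∧ Aᶜ ∈ Literature.Computability.Complexity.Nondeterministic.NP ∧ ∃ M : Literature.Computability.Complexity.OracleAlg Bool, M.IsPolyTime Computability.encodingBoolBool ∧ ∃ q : Polynomial ℕ, ∀ (n : ℕ) (x : Fin n → ℝ), M.run (fun qry : List Bool => cond (qry.headD false) (Computability.encodeBool (@decide (qry.tail ∈ A) (Classical.dec _))) ((fun qry : List Bool => Computability.encodeBool (decide ((0 : ℝ) ≤ ((Literature.Computability.Complexity.encodingIntBool.listBool).decode qry).elim (0 : ℝ) (fun l : List ℤ => ((l.getD 0 0 : ℤ) : ℝ) + ∑ i : Fin n, ((l.getD (i.val + 1) 0 : ℤ) : ℝ) * x i)))) qry.tail)) (q.eval n) (Computability.unaryEncodeNat n) = some (@decide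 (let g : ℕ → ℝ := fun m => (List.ofFn x).getD m 0; ∃ k : ℕ, 0 < k ∧ n = k + 2 * k * k ∧ ((∀ u : Fin k, ∃ u' : Fin k, g (k + (u.val * k + u'.val)) = 1) ∧ ∃ (σ : Fin k → Fin k) (R : Set (Fin k)) (π : Fin k → ℝ), (∃ v ∈ R, v.val = 0) ∧ ∀ u ∈ R, (g u.val = 1 → g (k + (u.val * k + (σ u).val)) = 1 ∧ σ u ∈ R ∧ π (σ u) ≤ π u + g (k + k * k + (u.val * k + (σ u).val))) ∧ (g u.val ≠ 1 → ∀ u' : Fin k, g (k + (u.val * k + u'.val)) = 1 → u' ∈ R ∧ π u' ≤ π u + g (k + k * k + (u.val * k + u'.val))))) (Classical.dec _))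

/-- item stmt-PneNP-2569 · crux (kind.auto-crux: conjecture-grade) · rank 9 · open · by planner
why it might fail: auto-crux — conjecture-grade statement (docstring avows it ('conjecture')); it is open, so it may simply be false
sources: conjecture-registry
[support] Boolean shadow / calibration: a poly-time sign-query algorithm for MPG_ℝ gives MPG_ℤ ∈ P
(decode the integer instance, run the step function, answer each sign query by exact integer
arithmetic on poly-bit numbers — queries have poly length hence poly-bit coefficients, FK Remark 1).
Contrapositive: the Boolean conjecture 'MPG ∉ P' implies X_add, so X_add is the WEAKER statement.
[FournierKoiran2000, Fact 1 (BP(P⁰_Rovs) = P)] [difficulty: L] -/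
@[route_item "route-PneNP-NoTardosTropics"]
def BooleanShadow : Prop :=
  (∃ M : Literature.Computability.Complexity.OracleAlg Bool, M.IsPolyTime Computability.encodingBoolBool ∧ ∃ q : Polynomial ℕ, ∀ (n : ℕ) (x : Fin n → ℝ), M.run (fun qry : List Bool => Computability.encodeBool (decide ((0 : ℝ) ≤ ((Literature.Computability.Complexity.encodingIntBool.listBool).decode qry).elim (0 : ℝ) (fun l : List ℤ => ((l.getD 0 0 : ℤ) : ℝ) + ∑ i : Fin n, ((l.getD (i.val + 1) 0 : ℤ) : ℝ) * x i)))) (q.eval n) (Computability.unaryEncodeNat n) = some (@decide (let g : ℕ → ℝ := fun m => (List.ofFn x).getD m 0; ∃ k : ℕ, 0 < k ∧ n = k + 2 * k * k ∧ ((∀ u : Fin k, ∃ u' : Fin k, g (k + (u.val * k + u'.val)) = 1) ∧ ∃ (σ : Fin k → Fin k) (R : Set (Fin k)) (π : Fin k → ℝ), (∃ v ∈ R, v.val = 0) ∧ ∀ u ∈ R, (g u.val = 1 → g (k + (u.val * k + (σ u).val)) = 1 ∧ σ u ∈ R ∧ π (σ u) ≤ π u + g (k + k * k + (u.val * k + (σ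 u).val))) ∧ (g u.val ≠ 1 → ∀ u' : Fin k, g (k + (u.val * k + u'.val)) = 1 → u' ∈ R ∧ π u' ≤ π u + g (k + k * k + (u.val * k + u'.val))))) (Classical.dec _))) → ((Literature.Computability.Complexity.encodingIntBool.listBool).toLanguage {l : List ℤ | let g : ℕ → ℝ := fun m => ((l.getD (m + 1) 0 : ℤ) : ℝ); ∃ k : ℕ, 0 < k ∧ l.length = 1 + (k + 2 * k * k) ∧ l.getD 0 0 = (k : ℤ) ∧ ((∀ u : Fin k, ∃ u' : Fin k, g (k + (u.val * k + u'.val)) = 1) ∧ ∃ (σ : Fin k → Fin k) (R : Set (Fin k)) (π : Fin k → ℝ), (∃ v ∈ R, v.val = 0) ∧ ∀ u ∈ R, (g u.val = 1 → g (k + (u.val * k + (σ u).val)) = 1 ∧ σ u ∈ R ∧ π (σ u) ≤ π u + g (k + k * k + (u.val * k + (σ u).val))) ∧ (g u.val ≠ 1 → ∀ u' : Fin k, g (k + (u.val * k + u'.val)) = 1 → u' ∈ R ∧ π u' ≤ π u + g (k + k * k + (u.val * k + u'.val))))}) ∈ Literature.Computability.Complexity.Classes.P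

/-- item stmt-PneNP-2564 · support · rank 2 · closed · proved by Summit.PneNP.PneNP.Theorems.FKThm3Digital_proof @ 537c4e8ff5f6 (prover) · by planner
why it might fail: Only via a model mismatch of this OracleAlg rendering (unary size input, 1-bit answers, listBool codec, no query-length clause) with Koiran's P⁰_Rovs; the mathematics is published (FK2000 Thm 2/3).
sources: FournierKoiran2000, FournierKoiran1998, Meyeraufderheide1984, Meiser1993, paper:galaxy-pdf-1066243140
[crux] Fournier–Koiran transfer, digital form, in the sign-oracle model: every real language with a
poly-time sign-query VERIFIER and Boolean witnesses of polynomial length (NDP⁰_add; witness y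
appended as boolPair (unaryEncodeNat n) y) is decided by a poly-time sign-query algorithm with
access to SOME Boolean oracle A ∈ NP (tagged queries: true::q asks A, false::q asks the sign of the
coded form). Published theorem [FournierKoiran2000, Thm 3 p.10 (NP⁰_Rovs ⊆ P⁰_Rovs(NP)) with Fact 2
(NP⁰ = NDP⁰) and Thm 2 p.4 (location ∈ FP⁰_Rovs(NP)); report hal-02102035 = galaxy-pdf-1066243140
read]; unproved in Lean, hence FIRST crux (plancard rule: unproved cone fact ⇒ first crux). Proof to
formalise: Meyer auf der Heide's recursion on little cubes of radius r_n (coarseness, 1/r_n =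
n^{n²}2^{2n²t(n)+O(n²)}), coefficient bounds of §2.2 (Lemma 3, Cor 2), NP prefix search for a
hyperplane meeting the cube (p.6), then the NP cell-decision (p.11). [deps: none] [difficulty: XL] -/
@[route_item "route-PneNP-NoTardosTropics", crux]
def FKThm3Digital : Prop :=
  ∀ L : (n : ℕ) → Set (Fin n → ℝ), (∃ M : Literature.Computability.Complexity.OracleAlg Bool, M.IsPolyTime Computability.encodingBoolBool ∧ ∃ q : Polynomial ℕ, ∀ (n : ℕ) (x : Fin n → ℝ), ((x ∈ L n) ↔ ∃ y : List Bool, y.length ≤ q.eval n ∧ M.run (fun qry : List Bool => Computability.encodeBool (decide ((0 : ℝ) ≤ ((Literature.Computability.Complexity.encodingIntBool.listBool).decode qry).elim (0 : ℝ) (fun l : List ℤ => ((l.getD 0 0 : ℤ) : ℝ) + ∑ i : Fin n, ((l.getD (i.val + 1) 0 : ℤ) : ℝ) * x i)))) (q.eval n) (Literature.Computability.Complexity.boolPair (Computability.unaryEncodeNat n) y) = some true)) → ∃ A : Language Bool, A ∈ Literature.Computability.Complexity.Nondeterministic.NP ∧ ∃ M : Literature.Computability.Complexity.OracleAlg Bool,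 M.IsPolyTime Computability.encodingBoolBool ∧ ∃ q : Polynomial ℕ, ∀ (n : ℕ) (x : Fin n → ℝ), M.run (fun qry : List Bool => cond (qry.headD false) (Computability.encodeBool (@decide (qry.tail ∈ A) (Classical.dec _))) ((fun qry : List Bool => Computability.encodeBool (decide ((0 : ℝ) ≤ ((Literature.Computability.Complexity.encodingIntBool.listBool).decode qry).elim (0 : ℝ) (fun l : List ℤ => ((l.getD 0 0 : ℤ) : ℝ) + ∑ i : Fin n, ((l.getD (i.val + 1) 0 : ℤ) : ℝ) * x i)))) qry.tail)) (q.eval n) (Computability.unaryEncodeNat n) = some (@decide (x ∈ L n) (Classical.dec _))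

/-- item stmt-PneNP-2567 · support · rank 9 · closed · proved by Summit.PneNP.PneNP.Theorems.MPGRealMemNDPadd_proof @ 55ac2e26d191 (prover) · by planner
[support] MPG_ℝ ∈ NDP⁰_add: a poly-time sign-query verifier with Boolean witness (σ, R) — check
arena totality and indicator bits by sign queries x_i = 1, closure of R, and feasibility of a
potential on R's edges ⟺ no negative cycle (Farkas / shortest-path duality on a finite digraph) by
Bellman–Ford, which uses only additions and comparisons of sums of ≤ k weights [Karp1978 for the
mean-cycle toolkit]. Assembly antecedent; provable now but long (an IsPolyTime step function via the
StackMachines/FP bricks). [difficulty: L] -/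
@[route_item "route-PneNP-NoTardosTropics", crux]
def MPGRealMemNDPadd : Prop :=
  ∃ M : Literature.Computability.Complexity.OracleAlg Bool, M.IsPolyTime Computability.encodingBoolBool ∧ ∃ q : Polynomial ℕ, ∀ (n : ℕ) (x : Fin n → ℝ), ((let g : ℕ → ℝ := fun m => (List.ofFn x).getD m 0; ∃ k : ℕ, 0 < k ∧ n = k + 2 * k * k ∧ ((∀ u : Fin k, ∃ u' : Fin k, g (k + (u.val * k + u'.val)) = 1) ∧ ∃ (σ : Fin k → Fin k) (R : Set (Fin k)) (π : Fin k → ℝ), (∃ v ∈ R, v.val = 0) ∧ ∀ u ∈ R, (g u.val = 1 → g (k + (u.val * k + (σ u).val)) = 1 ∧ σ u ∈ R ∧ π (σ u) ≤ π u + g (k + k * k + (u.val * k + (σ u).val))) ∧ (g u.val ≠ 1 → ∀ u' : Fin k, g (k + (u.val * k + u'.val)) = 1 → u' ∈ R ∧ π u' ≤ π u + g (k + k * k + (u.val * k + u'.val))))) ↔ ∃ y : List Bool, y.length ≤ q.eval n ∧ M.run (fun qry : List Bool => Computability.encodeBool (decide ((0 : ℝ) ≤ ((Literature.Computability.Complexity.encodingIntBool.listBool).decode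 qry).elim (0 : ℝ) (fun l : List ℤ => ((l.getD 0 0 : ℤ) : ℝ) + ∑ i : Fin n, ((l.getD (i.val + 1) 0 : ℤ) : ℝ) * x i)))) (q.eval n) (Literature.Computability.Complexity.boolPair (Computability.unaryEncodeNat n) y) = some true)

/-- item stmt-PneNP-2568 · support · rank 9 · closed · proved by Summit.PneNP.PneNP.Theorems.oracleRemoval_proof @ 1745924c7e22 (prover) · by planner
[support] If A ∈ P then a poly-time sign-query algorithm with oracle A (tagged queries) for a real
language L yields one without: answer true::q inside the step function with the P decider, replaying
the transcript (FP closed under composition — comp_mem_FP — and a polynomial bound on the simulated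
rounds). The 'P = NP ⇒ oracle removable' half of [FournierKoiran2000, proof of Thm 1 p.11]. Assembly
antecedent. [difficulty: M] -/
@[route_item "route-PneNP-NoTardosTropics", crux]
def OracleRemoval : Prop :=
  ∀ (A : Language Bool) (L : (n : ℕ) → Set (Fin n → ℝ)), A ∈ Literature.Computability.Complexity.Classes.P → (∃ M : Literature.Computability.Complexity.OracleAlg Bool, M.IsPolyTime Computability.encodingBoolBool ∧ ∃ q : Polynomial ℕ, ∀ (n : ℕ) (x : Fin n → ℝ), M.run (fun qry : List Bool => cond (qry.headD false) (Computability.encodeBool (@decide (qry.tail ∈ A) (Classical.dec _))) ((fun qry : List Bool => Computability.encodeBool (decide ((0 : ℝ) ≤ ((Literature.Computability.Complexity.encodingIntBool.listBool).decode qry).elim (0 : ℝ) (fun l : List ℤ => ((l.getD 0 0 : ℤ) : ℝ) + ∑ i : Fin n, ((l.getD (i.val + 1) 0 : ℤ) : ℝ) * x i)))) qry.tail)) (q.eval n) (Computability.unaryEncodeNat n) = some (@decide (x ∈ L n) (Classical.dec _))) → ∃ M : Literature.Computability.Complexity.OracleAlg Bool, M.IsPolyTime Computability.encodingBoolBool ∧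 ∃ q : Polynomial ℕ, ∀ (n : ℕ) (x : Fin n → ℝ), M.run (fun qry : List Bool => Computability.encodeBool (decide ((0 : ℝ) ≤ ((Literature.Computability.Complexity.encodingIntBool.listBool).decode qry).elim (0 : ℝ) (fun l : List ℤ => ((l.getD 0 0 : ℤ) : ℝ) + ∑ i : Fin n, ((l.getD (i.val + 1) 0 : ℤ) : ℝ) * x i)))) (q.eval n) (Computability.unaryEncodeNat n) = some (@decide (x ∈ L n) (Classical.dec _))

/-- item stmt-PneNP-2570 · support · rank 9 · closed · proved by Summit.PneNP.PneNP.Theorems.madHNonuniform_proof @ 2ce6db8d6664 (prover) · by planner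
[support] Non-uniform upper bound (why natural proofs cannot apply and uniformity is the whole
content): for some polynomial q, for every n there is a sign-query algorithm (arbitrary step
function = a linear decision tree) deciding MPG_ℝ(n) within q(n) rounds with queries of length ≤
q(n) (poly-bit coefficients). MPG_ℝ(n) is a union of faces of the arrangement of hyperplanes with
coefficients in {−1,0,1} (cycle sums, indicator equalities), so Meyer auf der Heide / Meiser point
location gives depth poly(n)·log #hyperplanes = poly(n) with coefficients bounded as in
[FournierKoiran2000 §2.2, Lemma 3 / Cor 2]; [Meyeraufderheide1984; Meiser1993]. Known theorem; heavy
to formalise. [difficulty: XL] -/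
@[route_item "route-PneNP-NoTardosTropics"]
def MadHNonuniform : Prop :=
  ∃ q : Polynomial ℕ, ∀ n : ℕ, ∃ M : Literature.Computability.Complexity.OracleAlg Bool, ∀ x : Fin n → ℝ, M.run (fun qry : List Bool => Computability.encodeBool (decide ((0 : ℝ) ≤ ((Literature.Computability.Complexity.encodingIntBool.listBool).decode qry).elim (0 : ℝ) (fun l : List ℤ => ((l.getD 0 0 : ℤ) : ℝ) + ∑ i : Fin n, ((l.getD (i.val + 1) 0 : ℤ) : ℝ) * x i)))) (q.eval n) (Computability.unaryEncodeNat n) = some (@decide (let g : ℕ → ℝ := fun m => (List.ofFn x).getD m 0; ∃ k : ℕ, 0 < k ∧ n = k + 2 * k * k ∧ ((∀ u : Fin k, ∃ u' : Fin k, g (k + (u.val * k + u'.val)) = 1) ∧ ∃ (σ : Fin k → Fin k) (R : Set (Fin k)) (π : Fin k → ℝ), (∃ v ∈ R, v.val = 0) ∧ ∀ u ∈ R, (g u.val = 1 → g (k + (u.val * k + (σ u).val)) = 1 ∧ σ u ∈ R ∧ π (σ u) ≤ π u + g (k + k * k + (u.val * k + (σ u).val))) ∧ (g u.val ≠ 1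 → ∀ u' : Fin k, g (k + (u.val * k + u'.val)) = 1 → u' ∈ R ∧ π u' ≤ π u + g (k + k * k + (u.val * k + u'.val))))) (Classical.dec _)) ∧ ∀ y ∈ M.queries (fun qry : List Bool => Computability.encodeBool (decide ((0 : ℝ) ≤ ((Literature.Computability.Complexity.encodingIntBool.listBool).decode qry).elim (0 : ℝ) (fun l : List ℤ => ((l.getD 0 0 : ℤ) : ℝ) + ∑ i : Fin n, ((l.getD (i.val + 1) 0 : ℤ) : ℝ) * x i)))) (q.eval n) (Computability.unaryEncodeNat n), y.length ≤ q.eval n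

/-- item stmt-PneNP-2571 · support · rank 9 · closed · proved by Summit.PneNP.PneNP.Theorems.glueNoTardos_proof @ 01abd5044f03 (prover) · by planner
[support] Glue #3 → #0: an oracle-free sign-query algorithm is an oracle algorithm that never sets
the tag bit (prefix every query with false; IsPolyTime is preserved under this linear-time rewriting
of the step function's output). [deps: NoTropicalTardos, XAdd] [difficulty: S] -/
@[route_item "route-PneNP-NoTardosTropics"]
def GlueNoTardos : Prop :=
  NoTropicalTardos → XAdd

-- earlier Assembly (stmt-PneNP-2572, replaced 2026-08-15T16:17:30Z -> stmt-PneNP-10506): retired by None — Literature.Computability.Complexity.P_bool_eq → Literature.Computability.Complexity.NP_bool_eq → Literature.Computability.Complexity.P_subset_NP → FKThm3Digital → OracleRemoval → MPGRealMemNDPadd → XAdd → PneNP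
/-- item stmt-PneNP-10506 · assembly · rank 1 · closed · proved by Summit.PneNP.PneNP.Theorems.noTardosTropics_assembly_proof @ e539d5869d69 (prover) · by planner
[assembly] XAdd → FKThm3Digital → MPGRealMemNDPadd → OracleRemoval → _root_.PneNP. Items only (no
Literature fact as hypothesis): the deciding theorem `closes` of this route file has exactly this
telescope and is PROVED (pure logic; bridges P_bool_eq_holds and NP_subset_NP_bool used inside its
proof), so this item is closed by `theorem … : Assembly := closes` in a Theorems file importing the
route module. Logic: ¬PneNP ⇒ NP_w0 Bool ⊆ P_w0 Bool ⇒ (bridges) Nondeterministic.NP ⊆ Classes.P;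
FKThm3Digital at L = MPG_ℝ (antecedent = MPGRealMemNDPadd) gives A ∈ NP with MPG_ℝ ∈ P⁰_add^A; A ∈
P, OracleRemoval strips the oracle; contradiction with XAdd. [deps: XAdd, FKThm3Digital,
MPGRealMemNDPadd, OracleRemoval] [difficulty: S] -/
@[route_item "route-PneNP-NoTardosTropics"]
def Assembly : Prop :=
  XAdd → FKThm3Digital → MPGRealMemNDPadd → OracleRemoval → _root_.PneNP

/-! D-0027 §2.1 — DECIDING THEOREM (planner-authored via `route open/edit --closes-file`; by planner-rbadge-PneNP-NoTardosTropics-b759eda1-g2-0 2026-08-15T16:17:30Z):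
its hypotheses are this route's items and its conclusion the sub-problem Statement (glue_lint), and it elaborates with this file. -/

@[closes "route-PneNP-NoTardosTropics"] theorem closes (hX : XAdd) (hFK : FKThm3Digital) (hMPG : MPGRealMemNDPadd) (hOR : OracleRemoval) :
    _root_.PneNP := by
  -- Pure logic over the four items; the PROVED Literature bridges enter inside the proof, never as hypotheses:
  -- `P_bool_eq_holds : PNPWave0.P Bool = Classes.P` (ClayProblem) and
  -- `NP_subset_NP_bool : Nondeterministic.NP ⊆ PNPWave0.NP Bool` (NPBridge).
  by_contra hne
  have hP : Literature.Computability.Complexity.PNPWave0.P Bool = Literature.Computability.Complexity.Classes.P :=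
    Literature.Computability.Complexity.P_bool_eq_holds
  have hN : Literature.Computability.Complexity.Nondeterministic.NP ⊆
      Literature.Computability.Complexity.PNPWave0.NP Bool :=
    Literature.Computability.Complexity.NP_subset_NP_bool
  -- ¬ PneNP (= ¬ ∃ L ∈ NP, L ∉ P in Cook's classes) ⇒ every (certificate-)NP language is in Classes.P
  have hsub : Literature.Computability.Complexity.Nondeterministic.NP ⊆ Literature.Computability.Complexity.Classes.P := by
    intro A hA
    by_contra hA'
    apply hne
    refine ⟨A, hN hA, ?_⟩
    rw [hP]
    exact hA'
  -- Fournier–Koiran transfer for the real language MPG_ℝ (its NDP⁰_add verifier is the item MPGRealMemNDPadd):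
  -- MPG_ℝ ∈ P⁰_add(A) for some Boolean A ∈ NP; A ∈ P by hsub; the oracle is then removable (OracleRemoval);
  -- the resulting oracle-free poly-time sign-query algorithm contradicts XAdd.
  obtain ⟨A, hA, hM⟩ := hFK _ hMPG
  exact hX (hOR A _ (hsub hA) hM)

end Summit.PneNP.PneNP.Theses.NoTardosTropics
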